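import Literature.AnabelianGeometry.SemiGraphs.TemperedCompactInVerticialFinite
import Literature.AnabelianGeometry.SemiGraphs.TemperedReconstructionR2bCompatProofsAt
import Literature.AnabelianGeometry.SemiGraphs.TemperedReconstructionCompatProofsAt
import Literature.AnabelianGeometry.SemiGraphs.TemperedReconstructionAssemblyThm37At
import Literature.AnabelianGeometry.SemiGraphs.TemperedReconstructionCor39UpToTwistProofsAt
import HarnessLib

/-!
# [SemiAnbd] Corollary 3.9: the three frozen named facts AT FINITE PAIRS OF GRAPHS

Mochizuki, *Semi-graphs of anabelioids*, Publ. RIMS **42** (2006), §3, Corollary 3.9, manuscript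
pp. 42–43 (proof p. 43: "by Theorem 3.7, (iii), (iv)"; p. 41: "Since the semi-graphs `𝔾_j` are all
finite") [cite: MochizukiSemiAnbd2006, Cor 3.9 pp.42-43].

PROOF-ONLY companion (0 defs) of `TemperedReconstruction.lean` (`Cor39`, FACT-LIST row F-1710) and
`TemperedReconstructionCompat.lean` (`QuasiGeometricGraphDataCompat`, F-2770; `Cor39Compat`, F-2771),
cell abc-iut, F wave seat abc-iut-f-175.  The three facts are ∀-countable-graph statements; their
reductions of record (`quasiGeometricGraphDataCompat_of_compactInVerticial`,
`cor39Compat_of_thm37_i_iii`, `corollary_3_9_of_thm37_i_iii`) rest on [SemiAnbd] Thm. 3.7 (iii)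
`CompactInVerticial`, which the tree now PROVES at every FINITE graph
(`compactInVerticialAt_of_finiteGraph`, abc-iut-L3-t8) and leaves open at infinite graphs (cell row
G-t6g3-2b).  This file records, with no new mathematics, the INSTANCE FORMS of the three rows at a pair
of FINITE graphs `𝒢`, `ℋ` satisfying the hypotheses of Cor. 3.9, for every pair of charts:

* F-2770 — (R2′) `QuasiGeometricGraphDataCompat` at the pair: UNCONDITIONAL
  (`quasiGeometricGraphDataCompatAt_of_finiteGraph`): a compatibly quasi-geometric
  `φ : π₁^temp(𝒢) → π₁^temp(ℋ)` admits a locally open morphism `𝒢 → ℋ` compatible with it on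
  verticial and edge homomorphisms;
* clause (a) of `Cor39` / `Cor39Compat` at the pair: UNCONDITIONAL (`cor39_a_of_finiteGraph`,
  `cor39_a_compat_of_finiteGraph`): a homomorphism induced (chosen conjugators, `Hom.Induces`) by a
  locally open morphism is quasi-geometric, indeed compatibly so;
* F-2771 — `Cor39Compat` at the pair modulo ONLY the step (R3) `InducesOfCompatible` at the pair
  (`cor39CompatAt_of_finiteGraph`; the chosen-conjugator reading of "induced", cell obstruction
  O-Cor39-1: the up-to-twist form is the unconditional `cor39CompatUpToTwistAt_of_finite`,
  abc-iut-w4-d064);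
* F-1710 — the literal `Cor39` at the pair modulo the literal step (R2) `QuasiGeometricGraphData` and
  (R3) at the pair (`cor39At_of_finiteGraph`; the literal reading of Def. 3.8 folds, cell finding
  t2g2-F1 / ruling χ2).

The ∀-countable rows themselves are restated with their exact residual: Thm. 3.7 (iii) AT THE GRAPHS
SATISFYING THE HYPOTHESES OF COR. 3.9 only (`…_of_compactInVerticialAt_cor39`).  Nothing here asserts
Thm. 3.7 (iii) for an infinite `𝔾`, grades a reading of Def. 3.8, or takes a side on [IUTchIII]
Cor. 3.12; typed ≠ proved.
-/

open CategoryTheory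

namespace Literature.AnabelianGeometry.SemiGraphs

namespace ProfiniteSemiGraph

universe u

variable {𝒢 ℋ : ProfiniteSemiGraph.{u}}

/-! ### F-2770: (R2′) at a finite pair — unconditional -/

/-- **(R2′) `QuasiGeometricGraphDataCompat` AT A PAIR OF FINITE GRAPHS — unconditional** (FACT-LIST
row F-2770, instance form; [SemiAnbd] Cor. 3.9, proof p. 42: "any quasi-geometric `φ` … determines a
map from the vertices of `𝒢` to the vertices of `ℋ` … a map from the edges of `𝒢` to the edges of `ℋ`
which is compatible", p. 43 "manifestly … locally open"): for FINITE `𝒢`, `ℋ` satisfying the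
hypotheses of Cor. 3.9 and any charts, a compatibly quasi-geometric `φ : π₁^temp(𝒢) → π₁^temp(ℋ)`
admits a locally open morphism `𝒢 → ℋ` compatible with `φ` on verticial and edge homomorphisms —
abc-iut-w4-d083's `quasiGeometricGraphDataCompatAt_of_compactInVerticialAt` with both Thm. 3.7 (iii)
inputs discharged by `compactInVerticialAt_of_finiteGraph`.
[cite: MochizukiSemiAnbd2006, Cor 3.9 pp.42-43] -/
theorem quasiGeometricGraphDataCompatAt_of_finiteGraph [Finite 𝒢.graph.Vertex] [Finite 𝒢.graph.Edge]
    [Finite ℋ.graph.Vertex] [Finite ℋ.graph.Edge] (h𝒢 : Cor39Hypotheses 𝒢) (hℋ : Cor39Hypotheses ℋ)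
    (c𝒢 : TemperedPiChart 𝒢) (cℋ : TemperedPiChart ℋ) (φ : c𝒢.G →ₜ* cℋ.G)
    (hφ : IsCompatiblyQuasiGeometric φ) :
    ∃ F : Hom 𝒢 ℋ, F.IsLocallyOpen ∧ F.CompatV c𝒢 cℋ φ ∧ F.CompatE c𝒢 cℋ φ :=
  quasiGeometricGraphDataCompatAt_of_compactInVerticialAt compactInVerticialAt_of_finiteGraph
    compactInVerticialAt_of_finiteGraph h𝒢 hℋ c𝒢 cℋ φ hφ

/-- The same with explicit finiteness hypotheses (print p. 41: "the semi-graphs `𝔾_j` are all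
finite"). [cite: MochizukiSemiAnbd2006, Cor 3.9 pp.42-43] -/
theorem quasiGeometricGraphDataCompatAt_of_finiteGraph' (hV𝒢 : Finite 𝒢.graph.Vertex)
    (hE𝒢 : Finite 𝒢.graph.Edge) (hVℋ : Finite ℋ.graph.Vertex) (hEℋ : Finite ℋ.graph.Edge)
    (h𝒢 : Cor39Hypotheses 𝒢) (hℋ : Cor39Hypotheses ℋ) (c𝒢 : TemperedPiChart 𝒢)
    (cℋ : TemperedPiChart ℋ) (φ : c𝒢.G →ₜ* cℋ.G) (hφ : IsCompatiblyQuasiGeometric φ) :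
    ∃ F : Hom 𝒢 ℋ, F.IsLocallyOpen ∧ F.CompatV c𝒢 cℋ φ ∧ F.CompatE c𝒢 cℋ φ :=
  quasiGeometricGraphDataCompatAt_of_finiteGraph h𝒢 hℋ c𝒢 cℋ φ hφ

/-- **The frozen ∀-countable F-2770 from its EXACT residual**: Thm. 3.7 (iii) at the graphs satisfying
the hypotheses of Cor. 3.9 (per-graph `CompactInVerticialAt`, open for infinite `𝔾` only) gives
`QuasiGeometricGraphDataCompat` — sharpening `quasiGeometricGraphDataCompat_of_compactInVerticial`
(which takes (iii) at every graph). [cite: MochizukiSemiAnbd2006, Cor 3.9 pp.42-43] -/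
theorem quasiGeometricGraphDataCompat_of_compactInVerticialAt_cor39
    (hiii : ∀ 𝒢 : ProfiniteSemiGraph.{u}, Cor39Hypotheses 𝒢 → CompactInVerticialAt 𝒢) :
    QuasiGeometricGraphDataCompat.{u} :=
  fun 𝒢 ℋ h𝒢 hℋ c𝒢 cℋ φ hφ =>
    quasiGeometricGraphDataCompatAt_of_compactInVerticialAt (hiii 𝒢 h𝒢) (hiii ℋ hℋ) h𝒢 hℋ c𝒢 cℋ φ hφ

/-! ### Clause (a) of `Cor39` / `Cor39Compat` at a finite pair — unconditional -/

/-- **Clause (a) of Cor. 3.9 AT A PAIR OF FINITE GRAPHS — unconditional** ([SemiAnbd] p. 42: "any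
locally open morphism of semi-graphs of anabelioids `𝒢 → ℋ` determines a morphism of temperoids
`B^temp(𝒢) → B^temp(ℋ)` … whose quasi-geometricity follows by 'substituting' the equivalences of
Theorem 3.7, (iv), into Definition 3.8"): for FINITE `𝒢`, `ℋ`, a homomorphism induced
(`Hom.Induces`, chosen conjugators) by a locally open morphism is quasi-geometric — (R1)
`InducesCompatible_holds` ≫ (R0) `InducedIsQuasiGeometric_of_at` with Thm. 3.7 (iv) at both graphs
(`maximalCompactIffVerticialAt_of_finiteGraph`). [cite: MochizukiSemiAnbd2006, Cor 3.9 p.42] -/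
theorem cor39_a_of_finiteGraph [Finite 𝒢.graph.Vertex] [Finite 𝒢.graph.Edge]
    [Finite ℋ.graph.Vertex] [Finite ℋ.graph.Edge] (h𝒢 : Cor39Hypotheses 𝒢) (hℋ : Cor39Hypotheses ℋ)
    (c𝒢 : TemperedPiChart 𝒢) (cℋ : TemperedPiChart ℋ) (F : Hom 𝒢 ℋ) (hF : F.IsLocallyOpen)
    (φ : c𝒢.G →ₜ* cℋ.G) (hind : F.Induces c𝒢 cℋ φ) : IsQuasiGeometric φ := by
  obtain ⟨hV, hE⟩ := InducesCompatible_holds 𝒢 ℋ h𝒢 hℋ c𝒢 cℋ F φ hind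
  exact InducedIsQuasiGeometric_of_at verticialInjective_holds maximalCompactIffVerticialAt_of_finiteGraph
    maximalCompactIffVerticialAt_of_finiteGraph h𝒢 hℋ c𝒢 cℋ F φ hF hV hE

/-- **Clause (a), compatible conclusion, AT A PAIR OF FINITE GRAPHS — unconditional**: a homomorphism
induced (chosen conjugators) by a locally open morphism is COMPATIBLY quasi-geometric — the chosen
family is one family (`Hom.induces_iff_inducesWith_chosen`), so clause (a) of abc-iut-w4-d080's
`cor39CompatUpToTwistAt` applies, with both Thm. 3.7 (iii) inputs discharged by
`compactInVerticialAt_of_finiteGraph` (cf. abc-iut-w4-d064's `cor39CompatUpToTwistAt_of_finite`).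
[cite: MochizukiSemiAnbd2006, Cor 3.9 p.42] -/
theorem cor39_a_compat_of_finiteGraph [Finite 𝒢.graph.Vertex] [Finite 𝒢.graph.Edge]
    [Finite ℋ.graph.Vertex] [Finite ℋ.graph.Edge] (h𝒢 : Cor39Hypotheses 𝒢) (hℋ : Cor39Hypotheses ℋ)
    (c𝒢 : TemperedPiChart 𝒢) (cℋ : TemperedPiChart ℋ) (F : Hom 𝒢 ℋ) (hF : F.IsLocallyOpen)
    (φ : c𝒢.G →ₜ* cℋ.G) (hind : F.Induces c𝒢 cℋ φ) : IsCompatiblyQuasiGeometric φ :=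
  (cor39CompatUpToTwistAt compactInVerticialAt_of_finiteGraph compactInVerticialAt_of_finiteGraph h𝒢 hℋ
      c𝒢 cℋ).1 F hF φ ⟨F.chosenConjugators, (F.induces_iff_inducesWith_chosen c𝒢 cℋ φ).mp hind⟩

/-! ### F-2771: `Cor39Compat` at a finite pair modulo (R3) at the pair -/

/-- **`Cor39Compat` AT A PAIR OF FINITE GRAPHS modulo ONLY the step (R3) at the pair** (FACT-LIST row
F-2771, instance form; [SemiAnbd] Cor. 3.9 p. 42, proof p. 43 l. 13 "we conclude that `φ` arises from a
morphism of graphs of anabelioids"): for FINITE `𝒢`, `ℋ`, if every homomorphism compatible with a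
locally open `F` is induced by `F` for the CHOSEN conjugators (`InducesOfCompatible` at the pair — the
one input of this reading the tree does not hold, cell obstruction O-Cor39-1; the up-to-twist form is
the unconditional `cor39CompatUpToTwistAt_of_finite`), then (a) induced ⇒ quasi-geometric and (b) every
compatibly quasi-geometric `φ` is induced by a locally open morphism, unique on vertices and edges —
`cor39Compat_of_thm37_i_iiiAt` with Thm. 3.7 (i) `verticialInjective_holds`, (iii) at both graphs
`compactInVerticialAt_of_finiteGraph`, and (R2′) `quasiGeometricGraphDataCompatAt_of_finiteGraph`.
[cite: MochizukiSemiAnbd2006, Cor 3.9 pp.42-43] -/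
theorem cor39CompatAt_of_finiteGraph [Finite 𝒢.graph.Vertex] [Finite 𝒢.graph.Edge]
    [Finite ℋ.graph.Vertex] [Finite ℋ.graph.Edge] (h𝒢 : Cor39Hypotheses 𝒢) (hℋ : Cor39Hypotheses ℋ)
    (c𝒢 : TemperedPiChart 𝒢) (cℋ : TemperedPiChart ℋ)
    (hR3 : ∀ (F : Hom 𝒢 ℋ) (φ : c𝒢.G →ₜ* cℋ.G), F.IsLocallyOpen → F.CompatV c𝒢 cℋ φ →
      F.CompatE c𝒢 cℋ φ → F.Induces c𝒢 cℋ φ) :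
    (∀ (F : Hom 𝒢 ℋ), F.IsLocallyOpen → ∀ φ : c𝒢.G →ₜ* cℋ.G, F.Induces c𝒢 cℋ φ →
        IsQuasiGeometric φ) ∧
      ∀ φ : c𝒢.G →ₜ* cℋ.G, IsCompatiblyQuasiGeometric φ →
        ∃ F : Hom 𝒢 ℋ, F.IsLocallyOpen ∧ F.Induces c𝒢 cℋ φ ∧
          ∀ F' : Hom 𝒢 ℋ, F'.IsLocallyOpen → F'.Induces c𝒢 cℋ φ →
            F'.base.vertexMap = F.base.vertexMap ∧ F'.base.edgeMap = F.base.edgeMap :=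
  cor39Compat_of_thm37_i_iiiAt verticialInjective_holds compactInVerticialAt_of_finiteGraph
    compactInVerticialAt_of_finiteGraph h𝒢 hℋ c𝒢 cℋ
    (quasiGeometricGraphDataCompatAt_of_finiteGraph h𝒢 hℋ c𝒢 cℋ) hR3

/-- **The frozen ∀-countable F-2771 from its EXACT residual**: Thm. 3.7 (iii) at the graphs satisfying
the hypotheses of Cor. 3.9 (open for infinite `𝔾` only) and the step (R3) `InducesOfCompatible`
(chosen conjugators, O-Cor39-1) give `Cor39Compat` — sharpening
`cor39Compat_of_forall_compactInVerticialAt` ((i) discharged by `verticialInjective_holds`, (R2′)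
inside by `quasiGeometricGraphDataCompat_of_compactInVerticialAt_cor39`).
[cite: MochizukiSemiAnbd2006, Cor 3.9 pp.42-43] -/
theorem cor39Compat_of_compactInVerticialAt_cor39
    (hiii : ∀ 𝒢 : ProfiniteSemiGraph.{u}, Cor39Hypotheses 𝒢 → CompactInVerticialAt 𝒢)
    (hR3 : InducesOfCompatible.{u}) : Cor39Compat.{u} :=
  fun 𝒢 ℋ h𝒢 hℋ c𝒢 cℋ =>
    cor39Compat_of_thm37_i_iiiAt verticialInjective_holds (hiii 𝒢 h𝒢) (hiii ℋ hℋ) h𝒢 hℋ c𝒢 cℋ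
      (quasiGeometricGraphDataCompat_of_compactInVerticialAt_cor39 hiii 𝒢 ℋ h𝒢 hℋ c𝒢 cℋ)
      (hR3 𝒢 ℋ h𝒢 hℋ c𝒢 cℋ)

/-! ### F-1710: the literal `Cor39` at a finite pair modulo (R2), (R3) at the pair -/

/-- **The literal `Cor39` AT A PAIR OF FINITE GRAPHS modulo the literal step (R2) and the step (R3) at
the pair** (FACT-LIST row F-1710, instance form; [SemiAnbd] Cor. 3.9 p. 42): for FINITE `𝒢`, `ℋ`, the
body of `Cor39` at the pair follows from (R2) `QuasiGeometricGraphData` at the pair (the LITERAL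
reading of Def. 3.8; cell finding t2g2-F1 / ruling χ2: the literal reading admits "fold" homomorphisms,
so this input is not expected to be dischargeable — the compatible reading is
`quasiGeometricGraphDataCompatAt_of_finiteGraph`) and (R3) `InducesOfCompatible` at the pair (chosen
conjugators, O-Cor39-1) — abc-iut-w4-d080's `corollary_3_9_of_thm37_i_iiiAt` with Thm. 3.7 (i)
`verticialInjective_holds` and (iii) at both graphs `compactInVerticialAt_of_finiteGraph`.
[cite: MochizukiSemiAnbd2006, Cor 3.9 pp.42-43] -/
theorem cor39At_of_finiteGraph [Finite 𝒢.graph.Vertex] [Finite 𝒢.graph.Edge]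
    [Finite ℋ.graph.Vertex] [Finite ℋ.graph.Edge] (h𝒢 : Cor39Hypotheses 𝒢) (hℋ : Cor39Hypotheses ℋ)
    (c𝒢 : TemperedPiChart 𝒢) (cℋ : TemperedPiChart ℋ)
    (hR2 : ∀ φ : c𝒢.G →ₜ* cℋ.G, IsQuasiGeometric φ →
      ∃ F : Hom 𝒢 ℋ, F.IsLocallyOpen ∧ F.CompatV c𝒢 cℋ φ ∧ F.CompatE c𝒢 cℋ φ)
    (hR3 : ∀ (F : Hom 𝒢 ℋ) (φ : c𝒢.G →ₜ* cℋ.G), F.IsLocallyOpen → F.CompatV c𝒢 cℋ φ →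
      F.CompatE c𝒢 cℋ φ → F.Induces c𝒢 cℋ φ) :
    (∀ (F : Hom 𝒢 ℋ), F.IsLocallyOpen → ∀ φ : c𝒢.G →ₜ* cℋ.G, F.Induces c𝒢 cℋ φ →
        IsQuasiGeometric φ) ∧
      ∀ φ : c𝒢.G →ₜ* cℋ.G, IsQuasiGeometric φ →
        ∃ F : Hom 𝒢 ℋ, F.IsLocallyOpen ∧ F.Induces c𝒢 cℋ φ ∧
          ∀ F' : Hom 𝒢 ℋ, F'.IsLocallyOpen → F'.Induces c𝒢 cℋ φ →
            F'.base.vertexMap = F.base.vertexMap ∧ F'.base.edgeMap = F.base.edgeMap :=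
  corollary_3_9_of_thm37_i_iiiAt verticialInjective_holds compactInVerticialAt_of_finiteGraph
    compactInVerticialAt_of_finiteGraph h𝒢 hℋ c𝒢 cℋ hR2 hR3

/-- **The frozen ∀-countable F-1710 from its EXACT residual**: Thm. 3.7 (iii) at the graphs
satisfying the hypotheses of Cor. 3.9 (open for infinite `𝔾` only), the literal step (R2)
`QuasiGeometricGraphData` (χ2) and the step (R3) `InducesOfCompatible` (O-Cor39-1) give the literal
`Cor39` — sharpening `corollary_3_9_of_forall_compactInVerticialAt` ((i) discharged by
`verticialInjective_holds`). [cite: MochizukiSemiAnbd2006, Cor 3.9 pp.42-43] -/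
theorem cor39_of_compactInVerticialAt_cor39
    (hiii : ∀ 𝒢 : ProfiniteSemiGraph.{u}, Cor39Hypotheses 𝒢 → CompactInVerticialAt 𝒢)
    (hR2 : QuasiGeometricGraphData.{u}) (hR3 : InducesOfCompatible.{u}) : Cor39.{u} :=
  fun 𝒢 ℋ h𝒢 hℋ c𝒢 cℋ =>
    corollary_3_9_of_thm37_i_iiiAt verticialInjective_holds (hiii 𝒢 h𝒢) (hiii ℋ hℋ) h𝒢 hℋ c𝒢 cℋ
      (hR2 𝒢 ℋ h𝒢 hℋ c𝒢 cℋ) (hR3 𝒢 ℋ h𝒢 hℋ c𝒢 cℋ)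

end ProfiniteSemiGraph

end Literature.AnabelianGeometry.SemiGraphs
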